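import Summits.QuantumFields.BalabanUV.Beta.GAN24.ContactOneGaugeCell
import Summits.QuantumFields.BalabanUV.Beta.GAN24.Push3
import Summits.QuantumFields.BalabanUV.Beta.GAN24.WardPairingCoarse
import Summits.QuantumFields.BalabanUV.Beta.KernelWardHColumnFixed
import Literature.MathematicalPhysics.QuantumFieldTheory.Balaban1983to89.Beta.KKTFluctuationEnergy
import Literature.MathematicalPhysics.QuantumFieldTheory.Balaban1983to89.Beta.AveragingWardStencils

/-!
# `BalabanUV.Beta.GAN24.WilsonTripleGaugeZero` — binder row G-an2-4 ∕ (CONV-C), W-slot CT-W, the (LT) ∕ (DL) rows' triple read-out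
# (leaf-03 g64's «TRIPLE WARD READ-OUT» `TripleWardReadout`, the OWNER gan24-p1 g32's E41): **THE BORN WILSON LETTER IS BLIND TO THREE PURE GAUGES —
# `push₃ (dz f) (dz h) (dz g) (wilsonA d) = 0`, in particular `push₃ Γ_L Γ_{L′} Γ_{L″} (wilsonA d) κ₀ U = 0` for the block-indicator gauge weights of ANY three
# blockings** (leaf-01 g69's exact-rational finding `Γ_L ≡ 0`, `g69/gamma/gamma_triple.py`, D = 2, 3 — AS A KERNEL IDENTITY, generic `d`)
# (G-an2-4 formalisation swarm → CRUX TEAM (2), leaf prover `b2b-balaban-gan24-formalise-leaf-01`, gen 70; INTENT I-leaf01-g70-1, journal `CLAIMS.log` l.48343)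

NOT IN PRINT; OUR BOOKKEEPING ([folklore] three tree lemmas deep: leaf-02 g46's index-slot law `ContactOneGaugeCellAlgebra.tsum_dz_mul_wilsonA_idx`
(`Σ'_u Σ_μ (dz g) μ u · W μ u x z a b = ½(g z − g x)·(d*d δ_{(b,z)})_a(x)`) and Maxwell contraction `ContactOneGaugeCellMaxwell.tsum_mul_curvAdj_curv_delta1`
(`Σ'_x Σ_a T a x·(d*d δ_{(b,z)})_a(x) = (d*d T)_b(z)`), node 5's `AffineAveraging.curv_dz` (`d ∘ d = 0`) and the lead's Green identity
`KKTFluctuationEnergy.lip1_curvAdj` (`⟨A, d*d m⟩ = ⟨curv A, curv m⟩`); leaf-03 g63's `WardPairingCoarse.curvAdj_curv_dz`; leaf-01 g43's `Push3.push₃` entry formula; 0 `def`, 0 cited fact, 0 `def … : Prop`, 0 sorry).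
HONEST FRAMING (cell contract, verbatim): «discharging `BetaPertH` makes Bałaban's UV stability UNCONDITIONAL — a real constructive-QFT result; it is NOT the
continuum limit and NOT the Clay problem.»  HONEST DEPENDENCY (verbatim): «continuum YM on T⁴ ⇐ BetaPertH ∧ nine spine estimates (0/9 proved); BetaPertH ⇐ (D1) ∧
(D4) ∧ CAP+tail; G-an2-4 gates asym, D1 and NE2/3/4.»

## Why
leaf-03 g64's `TripleWardReadout.codiff₁_codiff₁_divV_push₃_chain_eq` reads the literal's depth-`k` transported letter `push₃ T T T S` along the three block-constant
gauge modes EXACTLY: `δ_col δ_row divV (push₃ T T T S) = c³·push₃ Γ Γ Γ S`, `Γ = fun _ ↦ gaugeWt (Lc^{k+1})`, `c = (Lc^{(d+1)(k+1)})⁻¹`; their PART 2 turns the END's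
displayed layer bound `hLT` into a PER-LABEL refutation criterion on ONE born-level number, the TRIPLE FACE CHARGE `push₃ Γ Γ Γ S`.  THIS FILE shows where that
criterion CANNOT bite: on the born cubic Wilson table `S = wilsonA d` (an2's `StepJetData.wilsonA`, the field–field cubic letter of every literal of record) the
triple face charge is IDENTICALLY ZERO — for gauge-weight legs of any three blockings, indeed for any three EXACT leg families.  In words: the cubic Wilson
vertex vanishes on three longitudinal (pure-gauge) legs.  The in-print analogue, for the full effective action, is the third Ward–Takahashi identity at the
trivial configuration [Bałaban, CMP 109 (1987) p. 284, (4.15), with `B₁ = dλ₁`, `B₂ = dλ₂`]; it is cited for orientation only and used nowhere below.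
MECHANISM (three lines): a pure gauge `dz g` on the INDEX (slot) leg turns the table into the Maxwell contact `½(g z − g x)·(d*dδ_{(b,z)})_a(x)` (leaf-02);
a pure gauge `dz f` on the LEFT table leg contracts it to `½g(z)·(d*d dz f)_b(z) − ½(d*d(g·dz f))_b(z)`, whose first term is `0` (`d ∘ d = 0`); a pure gauge
`dz h` on the RIGHT table leg pairs the rest as `⟨dz h, d*d m⟩ = ⟨curv dz h, curv m⟩ = 0` (Green).

## What (generic `d`; `W := wilsonA d`; `d*d := curvAdj ∘ curv`; `e_κ := AffineAveraging.unitVec κ` inside `dz`)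
* §1 **`tsum_sum_dz_mul_curvAdj_curv_eq_zero`** (with leaf-03 g63's `WardPairingCoarse.curvAdj_curv_dz`, `d*d (dz f) = 0`, BY NAME) (`Σ'_x Σ_μ (dz h) μ x·(d*d m)_μ(x) = 0` for bounded `h`, summable `m`).
* §2 **`vertexW_wilsonA_inl_inl_of_exact`**: a slot leg with `w κ₀ U = dz g` reads the Wilson family as `vertexW w W κ₀ U x z (inl a) (inl b)
  = ½(g z − g x)·(d*dδ_{(b,z)})_a(x)` (no hypothesis on `g`: the table is finitely supported in its index site).
* §2b `summable_mul_wilsonA_translate_idx`, `tsum_dz_mul_wilsonA_translate_idx` (slot-translates `u ↦ W κ (u + v)`: the contact gauge function is translated,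
  `StepJetData.wilsonA_translate` ⨾ `curvAdj_curv_delta1_translate`), **`vertexW_wilsonSpan_inl_inl_of_exact`** (a finite linear combination
  `S κ u = Σ_i c_i·W κ (u + v_i)` — «the Wilson span», e.g. the END's block sums — reads as ONE contact with `G = Σ_i c_i·g(· − v_i)`).
* §3 **`push₃_inl_inl_eq_zero_of_contact`** (THE CORE: any letter whose slot read is a Maxwell contact `½(G z − G x)·(d*dδ_{(b,z)})_a(x)` with `G` bounded is
  annihilated by two exact table slices `dz f` (summable), `dz h` (`h` bounded)); **`push₃_wilsonA_inl_inl_eq_zero_of_exact`** (legs `l α₀ y = dz f`,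
  `r β₀ z = dz h`, `w κ₀ U = dz g`; `g`, `h` bounded, `dz f` summable ⟹ `push₃ l r w W κ₀ U y z (inl α₀) (inl β₀) = 0`); **`push₃_wilsonA_eq_zero_of_exact`**
  (all entries; multiplier rows ∕ columns by `Push3.push₃_inr_*`); **`push₃_wilsonSpan_eq_zero_of_exact`** (the same for the whole Wilson span).
* §4 `gaugeWt_eq_dz_blockInd` (an1's `gaugeWt L y = dz (blockInd L y)`, d1-leaf-07's `blockInd` ∕ `abs_blockInd_le` ∕ `summable_blockInd` BY NAME), **`push₃_gaugeWt_wilsonA_eq_zero`**: for blockings `L ≥ 1`, `L′`,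
  `L″` (any), `push₃ (fun _ ↦ gaugeWt L) (fun _ ↦ gaugeWt L′) (fun _ ↦ gaugeWt L″) W κ₀ U = 0` — leaf-03's PART 2 object at `S := wilsonA d`, three blockings free;
  `push₃_gaugeWt_smul_wilsonA_eq_zero` (the same for `c • W`, `Push3.push₃_smul`), **`push₃_gaugeWt_wilsonSpan_eq_zero`** (the same for every finite linear
  combination of slot-translates — no additivity hypothesis on the legs is needed: the span reads as ONE contact, §2b).
DECIDES NOTHING about the literal's (Q-R) ∕ `hLT`: it says that a triple-read criterion is VOID on the Wilson channel.  The
END's source letter `σ_m` is the COMPLETE W-slot Ward-residual letter of road-P2's `WardResidualSUnrolled` (leaf-03 g64 W-2, journal l.48371: `vertexOfM G_m (RM m)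
+ ½·dM (conjV G_m …) … −` sandwich words `+` mixFF words), NOT the bare table `cE·wilsonA`; so the criterion can bite only through those non-Wilson components, or on
the TRANSPORTED letters of depth `≥ 1` (leaf-03's PART 3 `TripleFaceChargeNested`), whose dressed legs inject the block-constant gauge mode at every seam
(`DressedLegSeamLowerBound` §3) — and the OWNER gan24-p1 g32's E41 (W4∕W5, l.48355) reads the complete letter with THIS file as its null control.  NOTHING of (LT) ∕ (DIV) ∕ (DL) ∕ K-LL-4′ ∕ «T2Shape»
discharged or refuted; 0 wall binders; NEVER «G-an2-4 closed» as (CONV-C); NOT D1, NOT `BetaPertH`, NOT continuum, NOT Clay; not in print — our bookkeeping.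
2026-08-23; no existing file touched.
-/

noncomputable section

open Finset
open scoped BigOperators
open Literature.MathematicalPhysics.QuantumFieldTheory
open Literature.MathematicalPhysics.QuantumFieldTheory.Balaban1983to89
open Literature.MathematicalPhysics.QuantumFieldTheory.Balaban1983to89.Beta
open ExpKernelCalculus (MKer)
open StepJetData (wilsonA)
open AffineAveraging (Form0 Form1 Form2 dz curv curvAdj curv_dz)
open AveragingContours (blk)
open KKTFluctuationKernel (delta1)
open KKTFluctuationEnergy (lip1 lip2 lip1_curvAdj summable_curv abs_dz_le summable_mul_of_bdd summable_dz)
open OneStepResolventKernel (Fib)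
open AveragingWardStencils (b6UnitVec_eq)
open Summit.QuantumFields.BalabanUV.Beta.KernelWardRelative (gaugeWt)
open Summit.QuantumFields.BalabanUV.Beta.KernelWardHColumnFixed (blockInd abs_blockInd_le summable_blockInd)
open Summit.QuantumFields.BalabanUV.Beta.GAN24.Push4 (vertexW vertexW_apply)
open Summit.QuantumFields.BalabanUV.Beta.GAN24.Push3 (push₃ push₃_inl_inl push₃_inr_left push₃_inr_right push₃_smul)
open Summit.QuantumFields.BalabanUV.Beta.GAN24.ContactOneGaugeCellAlgebra (tsum_dz_mul_wilsonA_idx summable_mul_wilsonA_idx)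
open Summit.QuantumFields.BalabanUV.Beta.GAN24.ContactOneGaugeCellMaxwell (tsum_mul_curvAdj_curv_delta1 summable_mul_curvAdj_curv_delta1)
open Summit.QuantumFields.BalabanUV.Beta.GAN24.WardPairingCoarse (curvAdj_curv_dz)

namespace Summit.QuantumFields.BalabanUV.Beta.GAN24.WilsonTripleGaugeZero

variable {d : ℕ}

/-! ## §1 The Green pairing of a pure gauge against a Maxwell image (`d*d ∘ d = 0` is leaf-03's `WardPairingCoarse.curvAdj_curv_dz`) -/

/-- [folklore] **A PURE GAUGE IS ORTHOGONAL TO EVERY MAXWELL IMAGE**: for a bounded gauge function `h` and a summable 1-form `m`,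
`Σ'_x Σ_μ (dz h) μ x · (d*d m)_μ(x) = 0` — Green's identity `⟨dz h, d*d m⟩ = ⟨curv (dz h), curv m⟩` (`KKTFluctuationEnergy.lip1_curvAdj`) and `curv ∘ dz = 0`. -/
theorem tsum_sum_dz_mul_curvAdj_curv_eq_zero {h : Form0 (d + 1) ℝ} {M : ℝ} (hh : ∀ x, |h x| ≤ M) {m : Form1 (d + 1) ℝ}
    (hm : ∀ κ, Summable (m κ)) :
    ∑' x, ∑ μ, dz h μ x * curvAdj (curv m) μ x = 0 := by
  have hG := lip1_curvAdj (A := dz h) (F := curv m) (M := 2 * M) (fun μ x => abs_dz_le hh μ x) (fun κ l => summable_curv hm κ l)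
  rw [curv_dz] at hG
  unfold lip1 lip2 at hG
  rw [hG]
  simp

/-! ## §2 A pure gauge on the slot leg reads the Wilson family as a Maxwell contact -/

/-- [folklore] **SLOT LEG EXACT ⟹ MAXWELL CONTACT** (leaf-02 g46's index-slot law inside leaf-17's `vertexW`): if the slot leg's slice at the coarse slot
`(κ₀, U)` is a pure gauge, `w κ₀ U = dz g`, then for all fine table indices
`vertexW w (wilsonA d) κ₀ U x z (inl a) (inl b) = ½·(g z − g x)·(d*d δ_{(b,z)})_a(x)` — no hypothesis on `g` (the table is finitely supported in its index site). -/
theorem vertexW_wilsonA_inl_inl_of_exact (w : Fin (d + 1) → (Fin (d + 1) → ℤ) → Fin (d + 1) → (Fin (d + 1) → ℤ) → ℝ)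
    (κ₀ : Fin (d + 1)) (U : Fin (d + 1) → ℤ) (g : Form0 (d + 1) ℝ) (hw : w κ₀ U = dz g)
    (x z : Fin (d + 1) → ℤ) (a b : Fin (d + 1)) :
    vertexW w (wilsonA d) κ₀ U x z (Sum.inl a) (Sum.inl b) = (1 / 2 : ℝ) * (g z - g x) * curvAdj (curv (delta1 b z)) a x := by
  rw [vertexW_apply, hw, ← tsum_dz_mul_wilsonA_idx x z a b g]
  exact (Summable.tsum_finsetSum fun μ _ => summable_mul_wilsonA_idx μ x z a b (dz g μ)).symm

/-! ## §2b The slot-translates of the Wilson family and their finite linear combinations («the Wilson span») -/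

/-- [folklore] Summability of a weight against a slot-translate of the Wilson family in its index site (finite support, via `StepJetData.wilsonA_translate`). -/
theorem summable_mul_wilsonA_translate_idx (μ : Fin (d + 1)) (v x z : Fin (d + 1) → ℤ) (a b : Fin (d + 1)) (q : (Fin (d + 1) → ℤ) → ℝ) :
    Summable fun u => q u * wilsonA d μ (u + v) x z (Sum.inl a) (Sum.inl b) := by
  refine (summable_mul_wilsonA_idx μ (x + -v) (z + -v) a b q).congr fun u => ?_
  rw [StepJetData.wilsonA_translate]
  rfl

/-- [folklore] **SLOT LEG EXACT ⟹ MAXWELL CONTACT, FOR A SLOT-TRANSLATE** `u ↦ W κ (u + v)`: the contact gauge function is translated, `½·(g(z − v) − g(x − v))·(d*d δ_{(b,z)})_a(x)`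
(§2 at the shifted table indices ⨾ translation invariance of the `d*d` matrix, `ContactOneGaugeCellMaxwell.curvAdj_curv_delta1_translate`). -/
theorem tsum_dz_mul_wilsonA_translate_idx (v x z : Fin (d + 1) → ℤ) (a b : Fin (d + 1)) (g : Form0 (d + 1) ℝ) :
    ∑' u, ∑ μ, dz g μ u * wilsonA d μ (u + v) x z (Sum.inl a) (Sum.inl b)
      = (1 / 2 : ℝ) * (g (z - v) - g (x - v)) * curvAdj (curv (delta1 b z)) a x := by
  have e : ∀ u, ∑ μ, dz g μ u * wilsonA d μ (u + v) x z (Sum.inl a) (Sum.inl b)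
      = ∑ μ, dz g μ u * wilsonA d μ u (x + -v) (z + -v) (Sum.inl a) (Sum.inl b) := by
    intro u
    refine Finset.sum_congr rfl fun μ _ => ?_
    rw [StepJetData.wilsonA_translate]
    rfl
  rw [tsum_congr e, tsum_dz_mul_wilsonA_idx (x + -v) (z + -v) a b g]
  have h1 := ContactOneGaugeCellMaxwell.curvAdj_curv_delta1_translate b a (z + -v) (x - z)
  have h2 := ContactOneGaugeCellMaxwell.curvAdj_curv_delta1_translate b a z (x - z)
  rw [show z + -v + (x - z) = x + -v by abel] at h1
  rw [show z + (x - z) = x by abel] at h2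
  rw [h1, ← h2, ← sub_eq_add_neg, ← sub_eq_add_neg]

/-- [folklore] **THE WILSON SPAN READS AS ONE MAXWELL CONTACT**: for a finite linear combination of slot-translates `S κ u = Σ_{i∈s} c_i·W κ (u + v_i)` and an exact slot
slice `w κ₀ U = dz g`, `vertexW w S κ₀ U x z (inl a) (inl b) = ½·(G z − G x)·(d*d δ_{(b,z)})_a(x)` with the COMBINED gauge function `G t := Σ_{i∈s} c_i·g(t − v_i)`. -/
theorem vertexW_wilsonSpan_inl_inl_of_exact {ι : Type*} (s : Finset ι) (c : ι → ℝ) (v : ι → Fin (d + 1) → ℤ)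
    (w : Fin (d + 1) → (Fin (d + 1) → ℤ) → Fin (d + 1) → (Fin (d + 1) → ℤ) → ℝ)
    (κ₀ : Fin (d + 1)) (U : Fin (d + 1) → ℤ) (g : Form0 (d + 1) ℝ) (hw : w κ₀ U = dz g)
    (x z : Fin (d + 1) → ℤ) (a b : Fin (d + 1)) :
    vertexW w (fun κ u x' z' a' b' => ∑ i ∈ s, c i * wilsonA d κ (u + v i) x' z' a' b') κ₀ U x z (Sum.inl a) (Sum.inl b)
      = (1 / 2 : ℝ) * ((∑ i ∈ s, c i * g (z - v i)) - ∑ i ∈ s, c i * g (x - v i)) * curvAdj (curv (delta1 b z)) a x := by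
  rw [vertexW_apply, hw]
  have hs : ∀ μ i, Summable fun u => dz g μ u * (c i * wilsonA d μ (u + v i) x z (Sum.inl a) (Sum.inl b)) := by
    intro μ i
    refine ((summable_mul_wilsonA_translate_idx μ (v i) x z a b (dz g μ)).mul_left (c i)).congr fun u => ?_
    ring
  have e1 : ∀ μ, ∑' u, dz g μ u * ∑ i ∈ s, c i * wilsonA d μ (u + v i) x z (Sum.inl a) (Sum.inl b)
      = ∑ i ∈ s, c i * ∑' u, dz g μ u * wilsonA d μ (u + v i) x z (Sum.inl a) (Sum.inl b) := by
    intro μ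
    have e : ∀ u, dz g μ u * ∑ i ∈ s, c i * wilsonA d μ (u + v i) x z (Sum.inl a) (Sum.inl b)
        = ∑ i ∈ s, dz g μ u * (c i * wilsonA d μ (u + v i) x z (Sum.inl a) (Sum.inl b)) := fun u => Finset.mul_sum _ _ _
    rw [tsum_congr e, Summable.tsum_finsetSum fun i _ => hs μ i]
    refine Finset.sum_congr rfl fun i _ => ?_
    rw [← tsum_mul_left]
    exact tsum_congr fun u => by ring
  simp only [e1]
  rw [Finset.sum_comm]
  have e2 : ∀ i ∈ s, ∑ μ, c i * ∑' u, dz g μ u * wilsonA d μ (u + v i) x z (Sum.inl a) (Sum.inl b)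
      = c i * ((1 / 2 : ℝ) * (g (z - v i) - g (x - v i)) * curvAdj (curv (delta1 b z)) a x) := by
    intro i _
    rw [← Finset.mul_sum, ← tsum_dz_mul_wilsonA_translate_idx (v i) x z a b g]
    congr 1
    exact (Summable.tsum_finsetSum fun μ _ => summable_mul_wilsonA_translate_idx μ (v i) x z a b (dz g μ)).symm
  rw [Finset.sum_congr rfl e2, ← Finset.sum_sub_distrib, Finset.mul_sum, Finset.sum_mul]
  refine Finset.sum_congr rfl fun i _ => ?_
  ring

/-! ## §3 Three exact legs annihilate every letter whose slot read is a Maxwell contact — the born Wilson letter and its span -/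

section Exact

variable {l r w : Fin (d + 1) → (Fin (d + 1) → ℤ) → Fin (d + 1) → (Fin (d + 1) → ℤ) → ℝ}
  {S : Fin (d + 1) → (Fin (d + 1) → ℤ) → MKer (d + 1) (Fib d)}
  {α₀ β₀ κ₀ : Fin (d + 1)} {y z U : Fin (d + 1) → ℤ} {f h G : Form0 (d + 1) ℝ} {MG Mh : ℝ}

/-- NOT IN PRINT; OUR BOOKKEEPING.  **THE CORE**: if the slot read of the letter at `(κ₀, U)` is a Maxwell contact with a bounded gauge function `G`,
`vertexW w S κ₀ U x z (inl a) (inl b) = ½(G z − G x)·(d*dδ_{(b,z)})_a(x)`, and the two table slices are exact — `l α₀ y = dz f` (`dz f` summable), `r β₀ z = dz h`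
(`h` bounded) — then `push₃ l r w S κ₀ U y z (inl α₀) (inl β₀) = 0`.  (Maxwell contraction on the left leg, `d*d(dz f) = 0` ⨾ §1 on the right leg with `m := G·dz f`.) -/
theorem push₃_inl_inl_eq_zero_of_contact
    (hV : ∀ (x z : Fin (d + 1) → ℤ) (a b : Fin (d + 1)),
      vertexW w S κ₀ U x z (Sum.inl a) (Sum.inl b) = (1 / 2 : ℝ) * (G z - G x) * curvAdj (curv (delta1 b z)) a x)
    (hl : l α₀ y = dz f) (hr : r β₀ z = dz h) (hf : ∀ κ, Summable (dz f κ)) (hh : ∀ v, |h v| ≤ Mh) (hG : ∀ v, |G v| ≤ MG) :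
    push₃ l r w S κ₀ U y z (Sum.inl α₀) (Sum.inl β₀) = 0 := by
  -- the weighted left leg `m := G · dz f`, summable
  set m : Form1 (d + 1) ℝ := fun κ v => G v * dz f κ v with hm
  have hms : ∀ κ, Summable (m κ) := fun κ => summable_mul_of_bdd hG (hf κ)
  -- the inner (left-leg) sum in closed form
  have inner : ∀ (z₁ : Fin (d + 1) → ℤ) (κ₂ : Fin (d + 1)),
      ∑' x, ∑ κ₁, l α₀ y κ₁ x * vertexW w S κ₀ U x z₁ (Sum.inl κ₁) (Sum.inl κ₂) = -(1 / 2 : ℝ) * curvAdj (curv m) κ₂ z₁ := by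
    intro z₁ κ₂
    have e : ∀ x, ∑ κ₁, l α₀ y κ₁ x * vertexW w S κ₀ U x z₁ (Sum.inl κ₁) (Sum.inl κ₂) =
        (1 / 2 : ℝ) * G z₁ * (∑ κ₁, dz f κ₁ x * curvAdj (curv (delta1 κ₂ z₁)) κ₁ x) -
          (1 / 2 : ℝ) * (∑ κ₁, m κ₁ x * curvAdj (curv (delta1 κ₂ z₁)) κ₁ x) := by
      intro x
      rw [Finset.mul_sum, Finset.mul_sum, ← Finset.sum_sub_distrib]
      refine Finset.sum_congr rfl fun κ₁ _ => ?_
      rw [hV x z₁ κ₁ κ₂, hl, hm]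
      ring
    rw [tsum_congr e, ((summable_mul_curvAdj_curv_delta1 (dz f) κ₂ z₁).mul_left _).tsum_sub
      ((summable_mul_curvAdj_curv_delta1 m κ₂ z₁).mul_left _), tsum_mul_left, tsum_mul_left,
      tsum_mul_curvAdj_curv_delta1 (dz f) κ₂ z₁, tsum_mul_curvAdj_curv_delta1 m κ₂ z₁, curvAdj_curv_dz]
    simp only [Pi.zero_apply, mul_zero, zero_sub]
    ring
  rw [push₃_inl_inl]
  have e2 : ∀ z₁, ∑ κ₂, (∑' x, ∑ κ₁, l α₀ y κ₁ x * vertexW w S κ₀ U x z₁ (Sum.inl κ₁) (Sum.inl κ₂)) * r β₀ z κ₂ z₁ =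
      -(1 / 2 : ℝ) * ∑ κ₂, dz h κ₂ z₁ * curvAdj (curv m) κ₂ z₁ := by
    intro z₁
    rw [Finset.mul_sum]
    refine Finset.sum_congr rfl fun κ₂ _ => ?_
    rw [inner z₁ κ₂, hr]
    ring
  rw [tsum_congr e2, tsum_mul_left, tsum_sum_dz_mul_curvAdj_curv_eq_zero hh hms, mul_zero]

variable {g : Form0 (d + 1) ℝ} {Mg : ℝ}

/-- NOT IN PRINT; OUR BOOKKEEPING.  **THE BORN WILSON LETTER IS BLIND TO THREE PURE GAUGES** (field–field entries): if the left table leg's slice is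
`l α₀ y = dz f` with `dz f` summable, the right table leg's slice is `r β₀ z = dz h` with `h` bounded, and the slot leg's slice is `w κ₀ U = dz g` with `g`
bounded, then `push₃ l r w (wilsonA d) κ₀ U y z (inl α₀) (inl β₀) = 0` (the core at §2's contact, `G = g`). -/
theorem push₃_wilsonA_inl_inl_eq_zero_of_exact (hl : l α₀ y = dz f) (hr : r β₀ z = dz h) (hw : w κ₀ U = dz g)
    (hf : ∀ κ, Summable (dz f κ)) (hh : ∀ v, |h v| ≤ Mh) (hg : ∀ v, |g v| ≤ Mg) :
    push₃ l r w (wilsonA d) κ₀ U y z (Sum.inl α₀) (Sum.inl β₀) = 0 :=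
  push₃_inl_inl_eq_zero_of_contact (fun x z a b => vertexW_wilsonA_inl_inl_of_exact w κ₀ U g hw x z a b) hl hr hf hh hg

/-- NOT IN PRINT; OUR BOOKKEEPING.  **ALL ENTRIES**: if EVERY slice of the left leg at the row block `y` and of the right leg at the column block `z` is exact
(`l α y = dz (f α)` with `dz (f α)` summable, `r β z = dz (h β)` with `h β` bounded) and the slot slice is `w κ₀ U = dz g` with `g` bounded, then
`push₃ l r w (wilsonA d) κ₀ U y z a b = 0` for every `a b : Fib d` (the multiplier rows ∕ columns of a push vanish identically, `Push3.push₃_inr_left ∕ _right`). -/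
theorem push₃_wilsonA_eq_zero_of_exact {fα hβ : Fin (d + 1) → Form0 (d + 1) ℝ}
    (hl : ∀ α, l α y = dz (fα α)) (hr : ∀ β, r β z = dz (hβ β)) (hw : w κ₀ U = dz g)
    (hf : ∀ α κ, Summable (dz (fα α) κ)) (hh : ∀ β v, |hβ β v| ≤ Mh) (hg : ∀ v, |g v| ≤ Mg) (a b : Fib d) :
    push₃ l r w (wilsonA d) κ₀ U y z a b = 0 := by
  rcases a with α | μ
  · rcases b with β | ν
    · exact push₃_wilsonA_inl_inl_eq_zero_of_exact (hl α) (hr β) hw (hf α) (hh β) hg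
    · simp only [push₃_inr_right]
  · simp only [push₃_inr_left]

/-- NOT IN PRINT; OUR BOOKKEEPING.  **THE WHOLE WILSON SPAN IS BLIND TO THREE PURE GAUGES**: for `S κ u = Σ_{i∈s} c_i·wilsonA d κ (u + v_i)` (any finite family of
slot-translates and real coefficients — e.g. the END's block sums of the born Wilson table) and three exact slices as above,
`push₃ l r w S κ₀ U y z a b = 0` for all entries (the core at §2b's combined contact function `G = Σ_i c_i·g(· − v_i)`, bounded by `Σ_i |c_i|·M_g`). -/
theorem push₃_wilsonSpan_eq_zero_of_exact {ι : Type*} (s : Finset ι) (c : ι → ℝ) (v : ι → Fin (d + 1) → ℤ)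
    {fα hβ : Fin (d + 1) → Form0 (d + 1) ℝ}
    (hl : ∀ α, l α y = dz (fα α)) (hr : ∀ β, r β z = dz (hβ β)) (hw : w κ₀ U = dz g)
    (hf : ∀ α κ, Summable (dz (fα α) κ)) (hh : ∀ β v, |hβ β v| ≤ Mh) (hg : ∀ v, |g v| ≤ Mg) (a b : Fib d) :
    push₃ l r w (fun κ u x' z' a' b' => ∑ i ∈ s, c i * wilsonA d κ (u + v i) x' z' a' b') κ₀ U y z a b = 0 := by
  rcases a with α | μ
  · rcases b with β | ν
    · refine push₃_inl_inl_eq_zero_of_contact (G := fun t => ∑ i ∈ s, c i * g (t - v i)) (MG := ∑ i ∈ s, |c i| * Mg)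
        (fun x z a b => vertexW_wilsonSpan_inl_inl_of_exact s c v w κ₀ U g hw x z a b) (hl α) (hr β) (hf α) (hh β) fun t => ?_
      calc |∑ i ∈ s, c i * g (t - v i)| ≤ ∑ i ∈ s, |c i * g (t - v i)| := Finset.abs_sum_le_sum_abs _ _
        _ ≤ ∑ i ∈ s, |c i| * Mg := Finset.sum_le_sum fun i _ => by
            rw [abs_mul]; exact mul_le_mul_of_nonneg_left (hg _) (abs_nonneg _)
    · simp only [push₃_inr_right]
  · simp only [push₃_inr_left]

end Exact

/-! ## §4 The block-indicator gauge weights: leaf-03's triple face charge of the born Wilson letter is zero -/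

/-- [folklore] an1's pure-gauge weight IS the differential of d1-leaf-07's block indicator: `gaugeWt L y = dz (blockInd L y)` (an2's and node 5's unit vectors agree,
`AveragingWardStencils.b6UnitVec_eq`); so `|blockInd| ≤ 1` (`abs_blockInd_le`) and, for `L ≥ 1`, `dz (blockInd L y) κ` is summable (`summable_blockInd` ⨾ `summable_dz`). -/
theorem gaugeWt_eq_dz_blockInd (L : ℕ) (y : Fin (d + 1) → ℤ) : gaugeWt L y = dz (blockInd L y) := by
  funext κ x
  simp only [gaugeWt, blockInd, dz, b6UnitVec_eq]

/-- NOT IN PRINT; OUR BOOKKEEPING.  **THE TRIPLE FACE CHARGE OF THE BORN WILSON LETTER IS ZERO** — leaf-03 g64's PART 2 object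
`push₃ Γ Γ Γ S κ₀ U y z (inl α₀) (inl β₀)` at `S := wilsonA d`, with the three gauge-weight legs allowed THREE DIFFERENT blockings `L ≥ 1`, `L′`, `L″`:
`push₃ (fun _ ↦ gaugeWt L) (fun _ ↦ gaugeWt L′) (fun _ ↦ gaugeWt L″) (wilsonA d) κ₀ U y z a b = 0` for all entries.  (leaf-01 g69's `Γ_L ≡ 0`, every `L`, every `d`.) -/
theorem push₃_gaugeWt_wilsonA_eq_zero {L : ℕ} (hL : 1 ≤ L) (L' L'' : ℕ) (κ₀ : Fin (d + 1)) (U y z : Fin (d + 1) → ℤ) (a b : Fib d) :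
    push₃ (fun (_ : Fin (d + 1)) => gaugeWt (d := d) L) (fun (_ : Fin (d + 1)) => gaugeWt (d := d) L')
      (fun (_ : Fin (d + 1)) => gaugeWt (d := d) L'') (wilsonA d) κ₀ U y z a b = 0 := by
  rcases a with α₀ | μ
  · rcases b with β₀ | ν
    · exact push₃_wilsonA_inl_inl_eq_zero_of_exact (α₀ := α₀) (β₀ := β₀) (κ₀ := κ₀) (y := y) (z := z) (U := U)
        (gaugeWt_eq_dz_blockInd L y) (gaugeWt_eq_dz_blockInd L' z) (gaugeWt_eq_dz_blockInd L'' U)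
        (fun κ => summable_dz (summable_blockInd hL y) κ) (abs_blockInd_le L' z) (abs_blockInd_le L'' U)
    · simp only [push₃_inr_right]
  · simp only [push₃_inr_left]

/-- NOT IN PRINT; OUR BOOKKEEPING.  The same for any scalar multiple of the born Wilson family (`Push3.push₃_smul`): `push₃ Γ_L Γ_{L′} Γ_{L″} (c • wilsonA d) κ₀ U = 0`. -/
theorem push₃_gaugeWt_smul_wilsonA_eq_zero {L : ℕ} (hL : 1 ≤ L) (L' L'' : ℕ) (c : ℝ) (κ₀ : Fin (d + 1)) (U y z : Fin (d + 1) → ℤ) (a b : Fib d) :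
    push₃ (fun (_ : Fin (d + 1)) => gaugeWt (d := d) L) (fun (_ : Fin (d + 1)) => gaugeWt (d := d) L')
      (fun (_ : Fin (d + 1)) => gaugeWt (d := d) L'') (fun κ u => c • wilsonA d κ u) κ₀ U y z a b = 0 := by
  rw [push₃_smul]
  simp only [Pi.smul_apply, smul_eq_mul, push₃_gaugeWt_wilsonA_eq_zero hL L' L'' κ₀ U y z a b, mul_zero]

/-- NOT IN PRINT; OUR BOOKKEEPING.  **leaf-03's TRIPLE FACE CHARGE VANISHES ON THE WHOLE WILSON SPAN**: for every finite family of slot-translates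
`S κ u = Σ_{i∈s} c_i·wilsonA d κ (u + v_i)` and blockings `L ≥ 1`, `L′`, `L″`, `push₃ Γ_L Γ_{L′} Γ_{L″} S κ₀ U y z a b = 0`. -/
theorem push₃_gaugeWt_wilsonSpan_eq_zero {ι : Type*} (s : Finset ι) (c : ι → ℝ) (v : ι → Fin (d + 1) → ℤ)
    {L : ℕ} (hL : 1 ≤ L) (L' L'' : ℕ) (κ₀ : Fin (d + 1)) (U y z : Fin (d + 1) → ℤ) (a b : Fib d) :
    push₃ (fun (_ : Fin (d + 1)) => gaugeWt (d := d) L) (fun (_ : Fin (d + 1)) => gaugeWt (d := d) L')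
      (fun (_ : Fin (d + 1)) => gaugeWt (d := d) L'')
      (fun κ u x' z' a' b' => ∑ i ∈ s, c i * wilsonA d κ (u + v i) x' z' a' b') κ₀ U y z a b = 0 :=
  push₃_wilsonSpan_eq_zero_of_exact s c v (κ₀ := κ₀) (y := y) (z := z) (U := U)
    (fun _ => gaugeWt_eq_dz_blockInd L y) (fun _ => gaugeWt_eq_dz_blockInd L' z) (gaugeWt_eq_dz_blockInd L'' U)
    (fun _ κ => summable_dz (summable_blockInd hL y) κ) (fun _ => abs_blockInd_le L' z) (abs_blockInd_le L'' U) a b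

end Summit.QuantumFields.BalabanUV.Beta.GAN24.WilsonTripleGaugeZero

end
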